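import Literature.NumberTheory.EllipticCurves.LocalTatePairingPoints
import Literature.NumberTheory.EllipticCurves.LocalTatePairingCupProductPadic
import Literature.NumberTheory.GaloisRepresentations.RestrictConjugateIso
import Literature.AnabelianGeometry.AbsoluteAnabelian.LocalResidueMapRestrictionIndex
import HarnessLib

/-!
# The local Tate pairing with points under RESTRICTION to a finite extension: `⟨Res x, P⟩_F = [F : F₀] · ⟨x, P⟩_{F₀}`

Topic `NumberTheory/EllipticCurves`; namespace `Literature.NumberTheory.EllipticCurves`. THEOREMS ONLY (no definition, no named
fact, no instance, no `sorry`). For an elliptic curve `W/K₀` (characteristic `0`), a tower `K₀ ⊆ F₀ ⊆ F` of fields and a prime `p`, the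
tree's `ℤ_p`-valued local Tate pairing with points `⟨x, P⟩ = tatePairingPoint W L p e … x P` (`LocalTatePairingPoints`: limit of the
level pairings `inv_L(pr_k x ∪_{e_k} κ_{p^k}(P))`, `L ∈ {F₀, F}`) satisfies the degree formula under restriction of the field:

  `⟨Res_{F/F₀} x₀, P₀⟩_F = [F : F₀] · ⟨x₀, P₀⟩_{F₀}`   (`x₀ ∈ H¹(F₀, T_pW)`, `P₀ ∈ E(F₀) ⊆ E(F)`),

Serre's `inv_F ∘ Res = [F : F₀] · inv_{F₀}` (*Corps locaux* XIII §3 Prop. 7; in the tree: `Prop121vii.invLevel_resMu`) combined with the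
functoriality of cup products, of the projections `pr_k` and of the Kummer classes under restriction. The one subtlety is the
tree's convention that `T_pW|_{Γ_L}` is restricted along the CHOSEN embedding `K̄₀ → L̄` (`absClosureEmbedding K₀ L`): the two embeddings
`K̄₀ → F̄₀ → F̄` and `K̄₀ → F̄` differ by an element `τ ∈ Γ_{K₀}` — `ι ∘ j₀ = j_F ∘ τ` (§1, `exists_towerEmb`; NOT merely a conjugator of the
restriction maps, which is all that `towerConjElement` of `RestrictConjugateIso` records) — and `Res_{F/F₀}` on `H¹(F₀, T_pW|_{Γ_{F₀}}) →
H¹(F, T_pW|_{Γ_F})` is «pull back along `res : Γ_F → Γ_{F₀}`, then apply `T(τ)`» (`ContinuousCohomology.map res (restrictConjHom … τ)`).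

* §1 `exists_towerEmb` (`∃ τ, ι ∘ j₀ = j_F ∘ τ`), `absGaloisRestrict_eq_conj_of_towerEmb` (`res_{F/K₀} = τ · (res_{F₀/K₀} ∘ res_{F/F₀}) · τ⁻¹`).
* §2 `cupProduct_weilContPairingTransfer_res` — the level-`p^k` Weil cup products: `(Res a) ∪_F (Res b) = Res_μ (a ∪_{F₀} b)` in
  `H²(Γ_F, μ_{p^k}(F̄))`, `Res_μ = Prop121vii.resMu` (cocycle-level computation; coefficient identity `ι(j₀ e(S,T)) = j_F(e(τS, τT))`).
* §3 `cohomologyMap_tateProjMor_res` — `pr_k ∘ Res = Res ∘ pr_k`.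
* §4 `res_kummerLevelClass` — `Res κ_{p^k}^{F₀}(P₀) = κ_{p^k}^F(P₀)` (the root `Q ∈ E(F̄₀)` of `P₀` read in `E(F̄)` through `ι`).
* §5 ★★ `tatePairingPoint_res` — THE DEGREE FORMULA `⟨Res x₀, P₀⟩_F = [F : F₀] · ⟨x₀, P₀⟩_{F₀}` (non-archimedean local fields of
  characteristic `0`, `F/F₀` finite), via `PadicInt.ext_of_toZModPow` and `toZModPow_tatePairingPoint`.

Use (crux K★ `stmt-BirchSwinnertonDyer-22226`, memo `…/Cruxes/StarredOptimalManinUnitFiveSeven/Lines/kato-lever-K3-legendre.md` §7.2 gap 2):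
Kato's formula `⟨[η], P⟩ = Tr(c · exp*(η) · log_ω P)` proved at a ramified completion `K_v` DESCENDS to `ℚ_p` along `K_v/ℚ_p` (degree
prime to `p`). BSD / K★ are not proved by this file.

## References
* J.-P. Serre, *Local Fields* (1979), XIII §3 Prop. 7 (`inv_E ∘ Res = [E:F] · inv_F`), VII/XI (cup products and restriction). [SerreLocalFields1979]
* J. Neukirch, A. Schmidt, K. Wingberg, *Cohomology of Number Fields* (2008), I §5 (1.5.3), (7.1.4), (7.2.6). [NeukirchSchmidtWingberg2008]
* J. H. Silverman, *AEC* (2009), VIII §2 (Kummer pairing, functoriality in the field). [SilvermanAEC2009]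
-/

noncomputable section

open scoped Classical

open CategoryTheory Function Field
open Literature.NumberTheory.GaloisRepresentations
open Literature.NumberTheory.GaloisRepresentations.DiscreteGaloisModule (mu MuCarrier)
open Literature.NumberTheory.PAdicHodge (restrictedTateRep restrictedTateRep_apply_apply)
open Literature.AnabelianGeometry.AbsoluteAnabelian (Prop121vii.invLevel Prop121vii.resMu Prop121vii.resCoeff Prop121vii.muRes
  Prop121vii.coe_muVal_muRes Prop121vii.resMu_apply Prop121vii.invLevel_resMu Prop121vii.resCoeff_hom_apply)

namespace Literature.NumberTheory.EllipticCurves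

open _root_.WeierstrassCurve

attribute [local instance] absoluteGaloisGroup_compactSpace
attribute [local instance] finite_geomTorsion_of_neZero

-- universe-monomorphic, as `PAdicHodge.restrictedTateRep`
variable {K₀ : Type} [Field K₀] [CharZero K₀] (W : WeierstrassCurve K₀) [W.IsElliptic]
  (F₀ : Type) [Field F₀] [Algebra K₀ F₀] (F : Type) [Field F] [Algebra K₀ F] [Algebra F₀ F] [IsScalarTower K₀ F₀ F]
  (p : ℕ) [hp : Fact p.Prime]

/-- `p^k ≠ 0`: instance bookkeeping for the levels. [folklore] -/
private theorem neZero_pow_r (k : ℕ) : NeZero (p ^ k) := ⟨pow_ne_zero k hp.out.ne_zero⟩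

attribute [local instance] neZero_pow_r

omit [CharZero K₀] [W.IsElliptic] in
/-- `p^k ≠ 0` in `ℤ`. [folklore] -/
private theorem pow_ne_zero_int_r (k : ℕ) : ((p ^ k : ℕ) : ℤ) ≠ 0 := by
  exact_mod_cast pow_ne_zero k hp.out.ne_zero

/-! ### §1 The embedding element of the tower -/

omit [CharZero K₀] in
/-- **The two `K₀`-embeddings `K̄₀ → F̄` of the tower differ by an element of `Γ_{K₀}`**: there is `τ ∈ Γ_{K₀}` with
`ι(j₀ x) = j_F(τ x)` for all `x ∈ K̄₀` (`j₀, j_F` the chosen embeddings into `F̄₀`, `F̄`; `ι : F̄₀ → F̄` the chosen `F₀`-embedding) —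
uniqueness of the algebraic closure up to `K₀`-isomorphism (tree `exists_absClosureEmbedding_comp_eq`).
[cite: MilneFT2022, Ch. 7, footnote after Prop. 7.6] [cite: SerreGaloisCohomology1997, I §2.4 (compatible pairs)] -/
theorem exists_towerEmb :
    ∃ τ : absoluteGaloisGroup K₀, ∀ x : AlgebraicClosure K₀,
      absClosureEmbedding F₀ F (absClosureEmbedding K₀ F₀ x) = absClosureEmbedding K₀ F (τ • x) := by
  obtain ⟨τ, hτ⟩ := exists_absClosureEmbedding_comp_eq K₀ F
    (((absClosureEmbedding F₀ F).restrictScalars K₀).comp (absClosureEmbedding K₀ F₀))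
  exact ⟨τ, fun x => (hτ x).symm⟩

omit [CharZero K₀] [IsScalarTower K₀ F₀ F] in
/-- **The restriction maps of the tower are conjugate by the embedding element**: `res_{F/K₀}(σ) = τ · res_{F₀/K₀}(res_{F/F₀} σ) · τ⁻¹`
(`ι(j₀(res·x)) = σ·ι(j₀ x)` on both sides, injectivity of `j_F`, faithfulness of the action).
[cite: MilneFT2022, Ch. 7, footnote after Prop. 7.6] [cite: SerreGaloisCohomology1997, I §2.4 (compatible pairs)] -/
theorem absGaloisRestrict_eq_conj_of_towerEmb {τ : absoluteGaloisGroup K₀}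
    (hτ : ∀ x : AlgebraicClosure K₀, absClosureEmbedding F₀ F (absClosureEmbedding K₀ F₀ x) = absClosureEmbedding K₀ F (τ • x))
    (σ : absoluteGaloisGroup F) :
    absGaloisRestrict K₀ F σ = τ * ((absGaloisRestrict K₀ F₀).comp (absGaloisRestrict F₀ F)) σ * τ⁻¹ := by
  have key : τ * absGaloisRestrict K₀ F₀ (absGaloisRestrict F₀ F σ) = absGaloisRestrict K₀ F σ * τ := by
    refine FaithfulSMul.eq_of_smul_eq_smul (α := AlgebraicClosure K₀) fun x => ?_
    apply (absClosureEmbedding K₀ F).toRingHom.injective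
    change absClosureEmbedding K₀ F ((τ * absGaloisRestrict K₀ F₀ (absGaloisRestrict F₀ F σ)) • x) =
      absClosureEmbedding K₀ F ((absGaloisRestrict K₀ F σ * τ) • x)
    rw [mul_smul, mul_smul, ← hτ, absGaloisRestrict_apply_smul, absGaloisRestrict_apply_smul, hτ,
      absGaloisRestrict_apply_smul]
  rw [show ((absGaloisRestrict K₀ F₀).comp (absGaloisRestrict F₀ F)) σ = absGaloisRestrict K₀ F₀ (absGaloisRestrict F₀ F σ) from rfl,
    key, mul_inv_cancel_right]

/-! ### §2 The level Weil cup products under restriction -/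

section Level

variable (e : (k : ℕ) → geomTorsion W ((p ^ k : ℕ) : ℤ) → geomTorsion W ((p ^ k : ℕ) : ℤ) → AlgebraicClosure K₀)
  (hμ : ∀ k S T, e k S T ^ (p ^ k) = 1)
  (hadd₁ : ∀ k S₁ S₂ T, e k (S₁ + S₂) T = e k S₁ T * e k S₂ T)
  (hadd₂ : ∀ k S T₁ T₂, e k S (T₁ + T₂) = e k S T₁ * e k S T₂)
  (hgal : ∀ k (σ : absoluteGaloisGroup K₀) (S T : geomTorsion W ((p ^ k : ℕ) : ℤ)), σ • e k S T = e k (σ • S) (σ • T))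
  {τ : absoluteGaloisGroup K₀}
  (hτ : ∀ x : AlgebraicClosure K₀, absClosureEmbedding F₀ F (absClosureEmbedding K₀ F₀ x) = absClosureEmbedding K₀ F (τ • x))
  (hconj : ∀ σ : absoluteGaloisGroup F,
    absGaloisRestrict K₀ F σ = τ * ((absGaloisRestrict K₀ F₀).comp (absGaloisRestrict F₀ F)) σ * τ⁻¹)

omit [CharZero K₀] [W.IsElliptic] [IsScalarTower K₀ F₀ F] in
include hgal hτ in
/-- The coefficient identity behind the restriction of the Weil cup product: `ι(j₀ e_k(S, T)) = j_F(e_k(τS, τT))`, i.e.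
`muRes (muTransfer_{F₀} (e_k(S,T))) = muTransfer_F (e_k(τS, τT))` in `μ_{p^k}(F̄)`. [cite: SilvermanAEC2009, III §8 (Galois equivariance of `e_m`)] -/
theorem muRes_muTransfer_weilPairingHom (k : ℕ) (S T : geomTorsion W ((p ^ k : ℕ) : ℤ)) :
    Prop121vii.muRes F₀ F (p ^ k) (muTransfer K₀ F₀ (p ^ k) (weilPairingHom W (p ^ k) (e k) (hμ k) (hadd₁ k) (hadd₂ k) S T)) =
      muTransfer K₀ F (p ^ k) (weilPairingHom W (p ^ k) (e k) (hμ k) (hadd₁ k) (hadd₂ k) (τ • S) (τ • T)) := by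
  apply muVal_injective F (p ^ k)
  refine Units.ext ?_
  rw [Prop121vii.coe_muVal_muRes, muVal_muTransfer, muVal_muTransfer, Units.coe_map, MonoidHom.coe_coe, Units.coe_map,
    MonoidHom.coe_coe, weilPairingHom_smul W p e hμ hadd₁ hadd₂ hgal, muVal_apply, Units.coe_smul, hτ]

omit [CharZero K₀] [W.IsElliptic] [IsScalarTower K₀ F₀ F] in
include hτ in
/-- ★ **The level-`p^k` Weil cup product under restriction**: for `a, b ∈ H¹(F₀, E[p^k])`,
`(Res a) ∪_F (Res b) = Res_μ(a ∪_{F₀} b)` in `H²(Γ_F, μ_{p^k}(F̄))`, where `Res = H¹(res_{F/F₀}; T(τ))` on `E[p^k]|` and `Res_μ = resMu`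
(pull back along `res_{F/F₀}`, coefficients along `ι`). Naturality of the cup product for the compatible pair `(res; T(τ), T(τ), ι)`.
[cite: NeukirchSchmidtWingberg2008, I §5 (1.5.3)] [cite: SerreLocalFields1979, XIII §3] -/
theorem cupProduct_weilContPairingTransfer_res (k : ℕ)
    (a b : continuousCohomology 1 (torsionRestricted W F₀ (p ^ k)).toTopRep) :
    (weilContPairingTransfer W F p e hμ hadd₁ hadd₂ hgal k).cupProduct
        (ContinuousCohomology.map (absGaloisRestrict F₀ F)
          ((W.torsionGaloisModule ((p ^ k : ℕ) : ℤ)).restrictConjHom ((absGaloisRestrict K₀ F₀).comp (absGaloisRestrict F₀ F))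
            (absGaloisRestrict K₀ F) τ hconj) 1 a)
        (ContinuousCohomology.map (absGaloisRestrict F₀ F)
          ((W.torsionGaloisModule ((p ^ k : ℕ) : ℤ)).restrictConjHom ((absGaloisRestrict K₀ F₀).comp (absGaloisRestrict F₀ F))
            (absGaloisRestrict K₀ F) τ hconj) 1 b) =
      Prop121vii.resMu F₀ F (p ^ k) 2 ((weilContPairingTransfer W F₀ p e hμ hadd₁ hadd₂ hgal k).cupProduct a b) := by
  obtain ⟨f, rfl⟩ := oneCocycleClass_surjective _ a
  obtain ⟨g, rfl⟩ := oneCocycleClass_surjective _ b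
  rw [map_oneCocycleClass, map_oneCocycleClass, ContPairing.cupProduct_oneCocycleClass_eq_twoCocycleClass,
    ContPairing.cupProduct_oneCocycleClass_eq_twoCocycleClass, Prop121vii.resMu_apply, map_twoCocycleClass]
  refine congrArg (twoCocycleClass _) (Subtype.ext (ContinuousMap.ext fun q => ?_))
  obtain ⟨σ, σ'⟩ := q
  rw [ContPairing.cupCocycle_apply, contTwoCocycles.pullback_apply, ContPairing.cupCocycle_apply,
    contOneCocycles.pullback_apply, contOneCocycles.pullback_apply, contOneCocycles.pullback_apply, _root_.map_mul,
    ← map_sub]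
  change muTransfer K₀ F (p ^ k) (weilPairingHom W (p ^ k) (e k) (hμ k) (hadd₁ k) (hadd₂ k) (τ • f.1 _) (τ • (g.1 _ - g.1 _))) =
    Prop121vii.muRes F₀ F (p ^ k) (muTransfer K₀ F₀ (p ^ k) (weilPairingHom W (p ^ k) (e k) (hμ k) (hadd₁ k) (hadd₂ k) (f.1 _) (g.1 _ - g.1 _)))
  rw [muRes_muTransfer_weilPairingHom W F₀ F p e hμ hadd₁ hadd₂ hgal hτ]

/-! ### §3 The projections `pr_k` commute with restriction -/

omit [CharZero K₀] [W.IsElliptic] [IsScalarTower K₀ F₀ F] in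
/-- **`pr_k ∘ Res = Res ∘ pr_k`**: the projection of the restricted class `Res x₀ ∈ H¹(F, T_pW|)` to `H¹(F, E[p^k]|)` is the restriction of
the projection (`pr_k` commutes with `T(τ)` and with pull-back). [cite: SilvermanAEC2009, III §7] -/
theorem cohomologyMap_tateProjMor_res (k : ℕ) (x₀ : continuousCohomology 1 (restrictedTateRep W F₀ p).toTopRep) :
    (cohomologyMap (tateProjMor W F p k) 1).hom
        (ContinuousCohomology.map (absGaloisRestrict F₀ F)
          ((W.tateGaloisRep p (W.continuous_galoisRepTate_holds p)).toIntRep.restrictConjHom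
            ((absGaloisRestrict K₀ F₀).comp (absGaloisRestrict F₀ F)) (absGaloisRestrict K₀ F) τ hconj) 1 x₀) =
      ContinuousCohomology.map (absGaloisRestrict F₀ F)
        ((W.torsionGaloisModule ((p ^ k : ℕ) : ℤ)).restrictConjHom ((absGaloisRestrict K₀ F₀).comp (absGaloisRestrict F₀ F))
          (absGaloisRestrict K₀ F) τ hconj) 1 ((cohomologyMap (tateProjMor W F₀ p k) 1).hom x₀) := by
  obtain ⟨η, rfl⟩ := oneCocycleClass_surjective _ x₀
  rw [map_oneCocycleClass, cohomologyMap_oneCocycleClass, cohomologyMap_oneCocycleClass, map_oneCocycleClass]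
  refine congrArg (oneCocycleClass _) (Subtype.ext (ContinuousMap.ext fun σ => ?_))
  rw [pullback_id_resIdHom_apply, contOneCocycles.pullback_apply, contOneCocycles.pullback_apply, pullback_id_resIdHom_apply,
    tateProjMor_hom_apply, tateProjMor_hom_apply]
  change tateProjHom W p k (τ • η.1 (absGaloisRestrict F₀ F σ)) =
    W.torsionGaloisModule ((p ^ k : ℕ) : ℤ) τ (tateProjHom W p k (η.1 (absGaloisRestrict F₀ F σ)))
  exact tateProjHom_smul W p k τ _

/-! ### §4 The Kummer classes under restriction -/

omit [CharZero K₀] [W.IsElliptic] in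
include hτ in
/-- `j_F ∘ τ = ι ∘ j₀` on points: `pointsMap_F(τ • P) = ι_*(pointsMap_{F₀} P)` for `P ∈ E(K̄₀)`.
[cite: SilvermanAEC2009, VIII §1 (Galois action on points)] [cite: SerreGaloisCohomology1997, I §2.4 (compatible pairs)] -/
theorem pointsMap_towerEmb_smul (P : geomPoints W) :
    pointsMap W F (τ • P) =
      WeierstrassCurve.Affine.Point.map ((absClosureEmbedding F₀ F).restrictScalars K₀)
        (show (W.baseChange (AlgebraicClosure F₀)).toAffine.Point from pointsMap W F₀ P) := by
  change WeierstrassCurve.Affine.Point.map _ (WeierstrassCurve.Affine.Point.map _ P) =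
    WeierstrassCurve.Affine.Point.map _ (WeierstrassCurve.Affine.Point.map _ P)
  rw [WeierstrassCurve.Affine.Point.map_map, WeierstrassCurve.Affine.Point.map_map]
  refine congrArg (fun f => WeierstrassCurve.Affine.Point.map f P) (AlgHom.ext fun x => ?_)
  exact (hτ x).symm

omit [CharZero K₀] [W.IsElliptic] in
/-- `ι_*` is equivariant along `res_{F/F₀}`: `ι_*((res σ) • Q) = σ • ι_* Q` on `E(F̄₀) → E(F̄)`.
[cite: SilvermanAEC2009, VIII §1 (Galois action on points)] [cite: SerreGaloisCohomology1997, I §2.4 and II §1.1] -/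
theorem localPointsMap_smul (σ : absoluteGaloisGroup F) (Q : localPoints W F₀) :
    WeierstrassCurve.Affine.Point.map ((absClosureEmbedding F₀ F).restrictScalars K₀)
        (show (W.baseChange (AlgebraicClosure F₀)).toAffine.Point from absGaloisRestrict F₀ F σ • Q) =
      (σ • (show localPoints W F from WeierstrassCurve.Affine.Point.map ((absClosureEmbedding F₀ F).restrictScalars K₀)
        (show (W.baseChange (AlgebraicClosure F₀)).toAffine.Point from Q)) : localPoints W F) := by
  rw [localPoints.smul_def, localPoints.smul_def]
  change WeierstrassCurve.Affine.Point.map _ (WeierstrassCurve.Affine.Point.map _ Q) =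
    WeierstrassCurve.Affine.Point.map _ (WeierstrassCurve.Affine.Point.map _ Q)
  rw [WeierstrassCurve.Affine.Point.map_map, WeierstrassCurve.Affine.Point.map_map]
  refine congrArg (fun f => WeierstrassCurve.Affine.Point.map f Q) (AlgHom.ext fun x => ?_)
  exact absGaloisRestrict_apply_smul F₀ F σ x

include hτ in
/-- ★ **The Kummer classes under restriction**: `Res κ_{p^k}^{F₀}(P₀) = κ_{p^k}^F(P)` whenever `P ∈ E(F)` is `P₀` read in `F`
(hypothesis `hP`: the same point of `E(F̄)`; e.g. `P = P₀.map (F₀ → F)`). The root `Q` of `P₀` in `E(F̄₀)` gives the root `ι_* Q` of `P`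
in `E(F̄)`, and `Q^{res σ} − Q ↦ (ι_*Q)^σ − ι_*Q`. [cite: SilvermanAEC2009, VIII §2] -/
theorem res_kummerLevelClass (k : ℕ) (P₀ : (W.baseChange F₀).toAffine.Point) (P : (W.baseChange F).toAffine.Point)
    (hP : (show (W.baseChange (AlgebraicClosure F)).toAffine.Point from
        W.baseChangeGeomPointsEquiv F (toGeomPoints (W.baseChange F) P)) =
      WeierstrassCurve.Affine.Point.map ((absClosureEmbedding F₀ F).restrictScalars K₀)
        (show (W.baseChange (AlgebraicClosure F₀)).toAffine.Point from
          W.baseChangeGeomPointsEquiv F₀ (toGeomPoints (W.baseChange F₀) P₀))) :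
    ContinuousCohomology.map (absGaloisRestrict F₀ F)
        ((W.torsionGaloisModule ((p ^ k : ℕ) : ℤ)).restrictConjHom ((absGaloisRestrict K₀ F₀).comp (absGaloisRestrict F₀ F))
          (absGaloisRestrict K₀ F) τ hconj) 1 (kummerLevelClass W F₀ p k P₀) =
      kummerLevelClass W F p k P := by
  -- the roots: `Q` of `P₀` in `E(F̄₀)`, `ι_* Q` of `P` in `E(F̄)`
  set Q : localPoints W F₀ := W.localZSMulRoot F₀ (pow_ne_zero_int_r p k) P₀ with hQdef
  have hQ : ((p ^ k : ℕ) : ℤ) • Q = W.baseChangeGeomPointsEquiv F₀ (toGeomPoints (W.baseChange F₀) P₀) :=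
    W.zsmul_localZSMulRoot F₀ (pow_ne_zero_int_r p k) P₀
  set ιpt : localPoints W F₀ →+ localPoints W F :=
    (WeierstrassCurve.Affine.Point.map ((absClosureEmbedding F₀ F).restrictScalars K₀) :
      (W.baseChange (AlgebraicClosure F₀)).toAffine.Point →+ (W.baseChange (AlgebraicClosure F)).toAffine.Point) with hιpt
  have hQF : ((p ^ k : ℕ) : ℤ) • ιpt Q = W.baseChangeGeomPointsEquiv F (toGeomPoints (W.baseChange F) P) := by
    rw [← map_zsmul, hQ]
    exact hP.symm
  rw [kummerLevelClass_eq_localKummerClass W F₀ p k P₀ Q hQ, kummerLevelClass_eq_localKummerClass W F p k P (ιpt Q) hQF,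
    WeierstrassCurve.localKummerClass, WeierstrassCurve.localKummerClass, map_oneCocycleClass]
  refine congrArg (oneCocycleClass _) (Subtype.ext (ContinuousMap.ext fun σ => ?_))
  rw [contOneCocycles.pullback_apply]
  -- compare in `E(F̄)` through the injective `pointsMap W F`
  apply Subtype.ext
  apply pointsMapOfEmb_injective W (closureEmb (K := K₀) F)
  change pointsMap W F (((W.torsionGaloisModule ((p ^ k : ℕ) : ℤ)) τ
      ((W.localKummerCocycle _ (pow_ne_zero_int_r p k) Q (W.zsmul_mem_fixedPoints_of_eq F₀ hQ)).1 _) :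
        geomTorsion W ((p ^ k : ℕ) : ℤ)) : geomPoints W) =
    pointsMap W F ((W.localKummerCocycle _ (pow_ne_zero_int_r p k) (ιpt Q) (W.zsmul_mem_fixedPoints_of_eq F hQF)).1 σ :
      geomTorsion W ((p ^ k : ℕ) : ℤ))
  rw [torsionGaloisModule_apply_apply, AddSubgroup.torsionBy.coe_smul, pointsMap_towerEmb_smul W F₀ F hτ,
    WeierstrassCurve.pointsMap_localKummerCocycle_apply, WeierstrassCurve.pointsMap_localKummerCocycle_apply]
  change ιpt (absGaloisRestrict F₀ F σ • Q - Q) = σ • ιpt Q - ιpt Q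
  rw [map_sub, hιpt]
  exact congrArg (· - _) (localPointsMap_smul W F₀ F σ Q)

end Level

/-! ### §5 The degree formula -/

section Descent

variable [ValuativeRel F₀] [TopologicalSpace F₀] [IsNonarchimedeanLocalField F₀] [CharZero F₀]
  [ValuativeRel F] [TopologicalSpace F] [IsNonarchimedeanLocalField F] [CharZero F] [FiniteDimensional F₀ F]
  (e : (k : ℕ) → geomTorsion W ((p ^ k : ℕ) : ℤ) → geomTorsion W ((p ^ k : ℕ) : ℤ) → AlgebraicClosure K₀)
  (hμ : ∀ k S T, e k S T ^ (p ^ k) = 1)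
  (hadd₁ : ∀ k S₁ S₂ T, e k (S₁ + S₂) T = e k S₁ T * e k S₂ T)
  (hadd₂ : ∀ k S T₁ T₂, e k S (T₁ + T₂) = e k S T₁ * e k S T₂)
  (hgal : ∀ k (σ : absoluteGaloisGroup K₀) (S T : geomTorsion W ((p ^ k : ℕ) : ℤ)), σ • e k S T = e k (σ • S) (σ • T))
  (hcompat : ∀ k (S T : geomTorsion W ((p ^ (k + 1) : ℕ) : ℤ)),
    e k (torsionMulHom W (p ^ (k + 1)) (p ^ k) p (pow_succ p k).symm S)
      (torsionMulHom W (p ^ (k + 1)) (p ^ k) p (pow_succ p k).symm T) = e (k + 1) S T ^ p)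
  {τ : absoluteGaloisGroup K₀}
  (hτ : ∀ x : AlgebraicClosure K₀, absClosureEmbedding F₀ F (absClosureEmbedding K₀ F₀ x) = absClosureEmbedding K₀ F (τ • x))
  (hconj : ∀ σ : absoluteGaloisGroup F,
    absGaloisRestrict K₀ F σ = τ * ((absGaloisRestrict K₀ F₀).comp (absGaloisRestrict F₀ F)) σ * τ⁻¹)

include hτ in
/-- ★★ **The degree formula for the local Tate pairing with points under restriction**: for non-archimedean local fields
`F₀ ⊆ F` of characteristic `0` (`F/F₀` finite), `x₀ ∈ H¹(F₀, T_pW|_{Γ_{F₀}})`, `P₀ ∈ E(F₀)` read as `P ∈ E(F)`: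
`⟨Res x₀, P⟩_F = [F : F₀] · ⟨x₀, P₀⟩_{F₀}` in `ℤ_p`, where `Res = H¹(res_{F/F₀}; T(τ))` for the embedding element `τ`
(`exists_towerEmb`, `absGaloisRestrict_eq_conj_of_towerEmb`). Levelwise: `inv_F ∘ Res_μ = [F:F₀] · inv_{F₀}` (`Prop121vii.invLevel_resMu`,
Serre XIII §3 Prop. 7) after §2–§4. [cite: SerreLocalFields1979, XIII §3 Prop. 7] [cite: NeukirchSchmidtWingberg2008, (7.1.4) and (7.2.6)] -/
theorem tatePairingPoint_res (x₀ : continuousCohomology 1 (restrictedTateRep W F₀ p).toTopRep)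
    (P₀ : (W.baseChange F₀).toAffine.Point) (P : (W.baseChange F).toAffine.Point)
    (hP : (show (W.baseChange (AlgebraicClosure F)).toAffine.Point from
        W.baseChangeGeomPointsEquiv F (toGeomPoints (W.baseChange F) P)) =
      WeierstrassCurve.Affine.Point.map ((absClosureEmbedding F₀ F).restrictScalars K₀)
        (show (W.baseChange (AlgebraicClosure F₀)).toAffine.Point from
          W.baseChangeGeomPointsEquiv F₀ (toGeomPoints (W.baseChange F₀) P₀))) :
    tatePairingPoint W F p e hμ hadd₁ hadd₂ hgal hcompat
        (ContinuousCohomology.map (absGaloisRestrict F₀ F)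
          ((W.tateGaloisRep p (W.continuous_galoisRepTate_holds p)).toIntRep.restrictConjHom
            ((absGaloisRestrict K₀ F₀).comp (absGaloisRestrict F₀ F)) (absGaloisRestrict K₀ F) τ hconj) 1 x₀) P =
      (Module.finrank F₀ F : ℤ_[p]) * tatePairingPoint W F₀ p e hμ hadd₁ hadd₂ hgal hcompat x₀ P₀ := by
  refine PadicInt.ext_of_toZModPow.mp fun k => ?_
  rw [map_mul, map_natCast, toZModPow_tatePairingPoint, toZModPow_tatePairingPoint, cohomologyMap_tateProjMor_res W F₀ F p hconj,
    ← res_kummerLevelClass W F₀ F p hτ hconj k P₀ P hP, levelTatePairing_eq_iota_weilCupProduct, levelTatePairing_eq_iota_weilCupProduct,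
    cohomologyMap_muRestrictIso_cupProduct_restrict, cohomologyMap_muRestrictIso_cupProduct_restrict]
  have h := cupProduct_weilContPairingTransfer_res W F₀ F p e hμ hadd₁ hadd₂ hgal hτ hconj k
    ((cohomologyMap (tateProjMor W F₀ p k) 1).hom x₀) (kummerLevelClass W F₀ p k P₀)
  exact (congrArg (Prop121vii.invLevel F (p ^ k)) h).trans (Prop121vii.invLevel_resMu F₀ F (p ^ k) _)

end Descent

end Literature.NumberTheory.EllipticCurves

end
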